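import Literature.AlgebraicTopology.SingularHomology.UniverseTransportIso
import Literature.AlgebraicTopology.SingularHomology.ExcisionTheorem
import Literature.AlgebraicTopology.SingularHomology.AcyclicPuncture
import HarnessLib

/-!
# Local homology `H_q(X | K)` is local: transfer along open embeddings, and the l.e.s. toolkit

A. Hatcher, *Algebraic Topology* (2002), §2.1 (long exact sequence of a pair, Thm. 2.13 ff.),
Thm. 2.20 (excision) and §3.3 p. 231/233 ("`Hₙ(X | A)` depends only on a neighbourhood of the
closed set `A`"). For the local homology `localHomologyOfSet R M X K q = H_q(X, X ∖ K; M)` of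
`Orientation.lean` (Mathlib's relative singular homology) this file proves:

* `localHomologyOfSet.isIso_map_subsetIncl_of_isClosed` — **excision for a closed set inside an
  open set**: `H_q(Ω | K) ≅ H_q(X | K)` for `K ⊆ Ω` closed, `Ω` open (the point case is
  `localHomology.isIso_map_subsetIncl_of_isOpen`, `LocalHomologyVanishing.lean`), together with
  its naturality in `K` (`map_subsetIncl_comp_restrictLocal`);
* `localHomologyOfSet.exists_linearEquiv_pair_of_isOpenEmbedding` — **transfer along an open
  embedding across universes**: for an open embedding `κ : O → Y` (any universes) and
  `L ⊆ K ⊆ O` with closed images, `R`-linear equivalences `H_q(O | K) ≃ H_q(Y | κ K)`,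
  `H_q(O | L) ≃ H_q(Y | κ L)` intertwining the restriction maps (homeomorphism `O ≃ₜ range κ`
  across universes, `localHomologyOfSet.xEquiv`, then excision in `Y`); hence vanishing and the
  surjectivity of restriction maps transfer between any two spaces containing homeomorphic open
  neighbourhoods of the compact sets (`isZero_iff_of_isOpenEmbedding`,
  `surjective_restrictLocal_iff_of_isOpenEmbedding`);
* the long-exact-sequence toolkit for `(Z, Z ∖ K)`: `isZero_localHomologyOfSet_succ_of_isZero`
  (`H_{q+1}(Z) = 0 = H_q(Z ∖ K) ⇒ H_{q+1}(Z | K) = 0`), `isIso_ofAbsolute_of_isZero`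
  (`H_{q+1}(Z ∖ K) = 0 = H_q(Z ∖ K) ⇒ H_{q+1}(Z) ≅ H_{q+1}(Z | K)`),
  `surjective_restrictLocal_of_isIso_ofAbsolute` (then `H(Z | K) → H(Z | L)` is onto), and
  `exists_linearEquiv_compl_of_isZero` (`H_{q+2}(Z) = 0 = H_{q+1}(Z) ⇒ H_{q+2}(Z | K) ≃ H_{q+1}(Z ∖ K)`).

These are the formal steps by which the local homology of a manifold along an embedded ball,
disc or circle is read off from the homology of the complement of its image in a sphere
(Hatcher Prop. 2B.1), used in `Literature/Topology/FourManifolds/ZeroSurgeryHomotopyBallSliceProofs.lean`.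
Everything is proved; no named facts, no definitions.

## References

* A. Hatcher, *Algebraic Topology*, CUP 2002, §2.1 Thm. 2.13–2.16, Thm. 2.20, §3.3 pp. 231–233
  [HatcherAT2002].
-/

noncomputable section

open CategoryTheory Limits Set Function Topology

universe u u₁ u₂ v

namespace Literature.AlgebraicTopology.SingularHomology

variable (R : Type v) [CommRing R] (M : Type v) [AddCommGroup M] [Module R M]

/-! ### Excision for a closed set inside an open set, and its naturality -/

namespace localHomologyOfSet

section Excision

variable {X : Type u} [TopologicalSpace X]

omit [TopologicalSpace X] in
/-- The inclusion `Ω ↪ X` as a map of pairs `(Ω, Ω ∖ K) → (X, X ∖ K)`. [folklore] -/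
theorem mapsTo_val_compl (Ω K : Set X) :
    Set.MapsTo (Subtype.val : Ω → X) ((Subtype.val ⁻¹' K : Set Ω)ᶜ) Kᶜ := fun _ hy h => hy h

/-- **Excision for local homology at a closed set** (Hatcher 2002, Thm. 2.20 / §3.3 p. 233:
`Hₙ(X | A) ≅ Hₙ(Ω | A)` for `Ω` an open neighbourhood of the closed set `A`): for `Ω` open,
`K ⊆ Ω` closed, `(Ω, Ω ∖ K) ↪ (X, X ∖ K)` induces isomorphisms `H_q(Ω | K; M) ≅ H_q(X | K; M)`
(the interiors of `X ∖ K` and `Ω` cover `X`). [cite: HatcherAT2002, Thm. 2.20] -/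
theorem isIso_map_subsetIncl_of_isClosed {Ω K : Set X} (hΩ : IsOpen Ω) (hK : IsClosed K)
    (hKΩ : K ⊆ Ω) (q : ℕ) :
    IsIso (relativeSingularHomology.map R M (subsetIncl Ω) (mapsTo_val_compl Ω K) q) := by
  have hcov : interior (Kᶜ : Set X) ∪ interior Ω = Set.univ := by
    rw [hΩ.interior_eq, hK.isOpen_compl.interior_eq]
    refine Set.eq_univ_of_forall fun y => ?_
    by_cases hy : y ∈ K
    · exact Or.inr (hKΩ hy)
    · exact Or.inl hy
  have h1 := relativeSingularHomology.isIso_map_of_interior_union_interior_holds R M X Kᶜ Ω hcov q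
  have heq : ((Subtype.val ⁻¹' K : Set Ω)ᶜ) = Subtype.val ⁻¹' Kᶜ := rfl
  have hid : Set.MapsTo (ContinuousMap.id Ω) ((Subtype.val ⁻¹' K : Set Ω)ᶜ) (Subtype.val ⁻¹' Kᶜ) :=
    fun y hy => heq ▸ hy
  haveI := relativeSingularHomology.isIso_map_id_of_eq R M heq hid q
  have hfac : relativeSingularHomology.map R M (subsetIncl Ω) (mapsTo_val_compl Ω K) q =
      relativeSingularHomology.map R M (ContinuousMap.id Ω) hid q ≫
        relativeSingularHomology.map R M (subsetIncl Ω) (Set.mapsTo_preimage Subtype.val Kᶜ) q := by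
    rw [← relativeSingularHomology.map_comp]
    rfl
  rw [hfac]
  haveI := h1
  infer_instance

/-- **Naturality of excision in the excised set**: for `L ⊆ K` the excision maps commute with
the restrictions `H_q(· | K) → H_q(· | L)` (both composites are the map of pairs
`(Ω, Ω ∖ K) → (X, X ∖ L)`; Hatcher 2002, §3.3). [cite: HatcherAT2002, §3.3 p. 233] -/
theorem map_subsetIncl_comp_restrictLocal {Ω : Set X} {K L : Set X} (h : L ⊆ K) (q : ℕ) :
    relativeSingularHomology.map R M (subsetIncl Ω) (mapsTo_val_compl Ω K) q ≫
        restrictLocal R M h q =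
      restrictLocal R M (preimage_mono h) q ≫
        relativeSingularHomology.map R M (subsetIncl Ω) (mapsTo_val_compl Ω L) q := by
  rw [restrictLocal, restrictLocal, ← relativeSingularHomology.map_comp,
    ← relativeSingularHomology.map_comp]
  rfl

end Excision

/-! ### Transfer along an open embedding across universes -/

section Transfer

variable {O : Type u₁} {Y : Type u₂} [TopologicalSpace O] [TopologicalSpace Y]

omit [TopologicalSpace O] [TopologicalSpace Y] in
/-- The image of `K` in `range κ` is the preimage of `κ '' K`. [folklore] -/
theorem image_rangeFactorization_eq (κ : O → Y) (K : Set O) :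
    Set.rangeFactorization κ '' K = Subtype.val ⁻¹' (κ '' K) := by
  ext ⟨y, x₀, rfl⟩
  simp only [Set.mem_image, Set.mem_preimage]
  constructor
  · rintro ⟨x, hx, hxy⟩
    exact ⟨x, hx, congrArg Subtype.val hxy⟩
  · rintro ⟨x, hx, hxy⟩
    exact ⟨x, hx, Subtype.ext hxy⟩

/-- **Local homology transfers along an open embedding, naturally in the set** (Hatcher 2002,
§3.3 p. 231/233: `Hₙ(X | A)` only depends on a neighbourhood of the closed set `A`, up to
homeomorphism). Let `κ : O → Y` be an open embedding between spaces in arbitrary universes and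
`L ⊆ K ⊆ O` with `κ K`, `κ L` closed in `Y`. Then there are `R`-linear equivalences
`T_K : H_q(O | K; M) ≃ H_q(Y | κ K; M)` and `T_L : H_q(O | L; M) ≃ H_q(Y | κ L; M)` with
`T_L ∘ res = res ∘ T_K` for the restriction maps `res : H_q(· | K) → H_q(· | L)`: the composite of
the homeomorphism `O ≃ₜ range κ` (across universes, `localHomologyOfSet.xEquiv`) and excision of
`Y ∖ range κ` (`isIso_map_subsetIncl_of_isClosed`). [cite: HatcherAT2002, §3.3 p. 233] -/
theorem exists_linearEquiv_pair_of_isOpenEmbedding {κ : O → Y} (hκ : IsOpenEmbedding κ)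
    {K L : Set O} (hLK : L ⊆ K) (hK : IsClosed (κ '' K)) (hL : IsClosed (κ '' L)) (q : ℕ) :
    ∃ (TK : localHomologyOfSet R M O K q ≃ₗ[R] localHomologyOfSet R M Y (κ '' K) q)
      (TL : localHomologyOfSet R M O L q ≃ₗ[R] localHomologyOfSet R M Y (κ '' L) q),
      ∀ x, TL (restrictLocal R M hLK q x) = restrictLocal R M (Set.image_mono hLK) q (TK x) := by
  -- the homeomorphism `O ≃ₜ range κ` and the images of `K`, `L` in `range κ`
  set e : O ≃ₜ ↥(Set.range κ) := hκ.isEmbedding.toHomeomorph with he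
  have heK : e '' K = Subtype.val ⁻¹' (κ '' K) := image_rangeFactorization_eq κ K
  have heL : e '' L = Subtype.val ⁻¹' (κ '' L) := image_rangeFactorization_eq κ L
  -- step 1: across universes along `e`
  let E₁K := localHomologyOfSet.xEquiv R M e K q
  let E₁L := localHomologyOfSet.xEquiv R M e L q
  -- step 2: the identity of `range κ` as a map of pairs along the set identities `heK`, `heL`
  have hidK : Set.MapsTo (ContinuousMap.id ↥(Set.range κ)) (e '' K)ᶜ
      (Subtype.val ⁻¹' (κ '' K) : Set ↥(Set.range κ))ᶜ := fun y hy => heK ▸ hy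
  have hidL : Set.MapsTo (ContinuousMap.id ↥(Set.range κ)) (e '' L)ᶜ
      (Subtype.val ⁻¹' (κ '' L) : Set ↥(Set.range κ))ᶜ := fun y hy => heL ▸ hy
  haveI hI₂K := relativeSingularHomology.isIso_map_id_of_eq R M (congrArg compl heK) hidK q
  haveI hI₂L := relativeSingularHomology.isIso_map_id_of_eq R M (congrArg compl heL) hidL q
  let E₂K := (asIso (relativeSingularHomology.map R M (ContinuousMap.id ↥(Set.range κ)) hidK q)).toLinearEquiv
  let E₂L := (asIso (relativeSingularHomology.map R M (ContinuousMap.id ↥(Set.range κ)) hidL q)).toLinearEquiv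
  -- step 3: excision of `Y ∖ range κ`
  haveI hI₃K := isIso_map_subsetIncl_of_isClosed R M hκ.isOpen_range hK
    (Set.image_subset_range κ K) q
  haveI hI₃L := isIso_map_subsetIncl_of_isClosed R M hκ.isOpen_range hL
    (Set.image_subset_range κ L) q
  let E₃K := (asIso (relativeSingularHomology.map R M (subsetIncl (Set.range κ))
    (mapsTo_val_compl (Set.range κ) (κ '' K)) q)).toLinearEquiv
  let E₃L := (asIso (relativeSingularHomology.map R M (subsetIncl (Set.range κ))
    (mapsTo_val_compl (Set.range κ) (κ '' L)) q)).toLinearEquiv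
  refine ⟨E₁K ≪≫ₗ (E₂K ≪≫ₗ E₃K), E₁L ≪≫ₗ (E₂L ≪≫ₗ E₃L), fun x => ?_⟩
  simp only [LinearEquiv.trans_apply]
  -- naturality of each step with respect to restriction
  have n1 : E₁L (restrictLocal R M hLK q x) = restrictLocal R M (Set.image_mono hLK) q (E₁K x) :=
    localHomologyOfSet.xEquiv_restrictLocal R M e hLK q x
  have n2 : ∀ y, E₂L (restrictLocal R M (Set.image_mono hLK) q y) =
      restrictLocal R M (preimage_mono (Set.image_mono hLK)) q (E₂K y) := by
    intro y
    change (restrictLocal R M (Set.image_mono hLK) q ≫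
        relativeSingularHomology.map R M (ContinuousMap.id ↥(Set.range κ)) hidL q) y =
      (relativeSingularHomology.map R M (ContinuousMap.id ↥(Set.range κ)) hidK q ≫
        restrictLocal R M (preimage_mono (Set.image_mono hLK)) q) y
    congr 1
    rw [restrictLocal, restrictLocal, ← relativeSingularHomology.map_comp,
      ← relativeSingularHomology.map_comp]
  have n3 : ∀ z, E₃L (restrictLocal R M (preimage_mono (Set.image_mono hLK)) q z) =
      restrictLocal R M (Set.image_mono hLK) q (E₃K z) := by
    intro z
    change (restrictLocal R M (preimage_mono (Set.image_mono hLK)) q ≫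
        relativeSingularHomology.map R M (subsetIncl (Set.range κ))
          (mapsTo_val_compl (Set.range κ) (κ '' L)) q) z =
      (relativeSingularHomology.map R M (subsetIncl (Set.range κ))
          (mapsTo_val_compl (Set.range κ) (κ '' K)) q ≫
        restrictLocal R M (Set.image_mono hLK) q) z
    rw [map_subsetIncl_comp_restrictLocal]
  rw [n1, n2, n3]

/-- **Vanishing of local homology transfers along open embeddings** (both ways): for an open
embedding `κ : O → Y` and `K ⊆ O` with `κ K` closed, `H_q(O | K; M) = 0 ↔ H_q(Y | κ K; M) = 0`.
[cite: HatcherAT2002, §3.3 p. 233] -/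
theorem isZero_iff_of_isOpenEmbedding {κ : O → Y} (hκ : IsOpenEmbedding κ) {K : Set O}
    (hK : IsClosed (κ '' K)) (q : ℕ) :
    IsZero (localHomologyOfSet R M O K q) ↔ IsZero (localHomologyOfSet R M Y (κ '' K) q) := by
  obtain ⟨TK, -, -⟩ := exists_linearEquiv_pair_of_isOpenEmbedding R M hκ (subset_refl K) hK hK q
  exact isZero_iff_of_linearEquiv R TK

/-- **Surjectivity of restriction maps transfers along open embeddings** (both ways): for an open
embedding `κ : O → Y` and `L ⊆ K ⊆ O` with closed images, `H_q(O | K) → H_q(O | L)` is onto iff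
`H_q(Y | κ K) → H_q(Y | κ L)` is. [cite: HatcherAT2002, §3.3 p. 233] -/
theorem surjective_restrictLocal_iff_of_isOpenEmbedding {κ : O → Y} (hκ : IsOpenEmbedding κ)
    {K L : Set O} (hLK : L ⊆ K) (hK : IsClosed (κ '' K)) (hL : IsClosed (κ '' L)) (q : ℕ) :
    Surjective (restrictLocal R M hLK q) ↔
      Surjective (restrictLocal R M (Set.image_mono hLK) q : _ → localHomologyOfSet R M Y (κ '' L) q) := by
  obtain ⟨TK, TL, hT⟩ := exists_linearEquiv_pair_of_isOpenEmbedding R M hκ hLK hK hL q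
  have hfun : (TL : _ → _) ∘ (restrictLocal R M hLK q : _ → _) =
      (restrictLocal R M (Set.image_mono hLK) q : _ → _) ∘ (TK : _ → _) := funext hT
  constructor
  · intro h
    have h2 : Surjective ((TL : _ → _) ∘ (restrictLocal R M hLK q : _ → _)) :=
      TL.surjective.comp h
    rw [hfun] at h2
    exact Surjective.of_comp h2
  · intro h
    have h2 : Surjective ((restrictLocal R M (Set.image_mono hLK) q : _ → _) ∘ (TK : _ → _)) :=
      h.comp TK.surjective
    rw [← hfun] at h2
    exact (Surjective.of_comp_iff' TL.bijective _).1 h2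

end Transfer

end localHomologyOfSet

/-! ### The long exact sequence toolkit for `(Z, Z ∖ K)` -/

section LES

variable {Z : Type u} [TopologicalSpace Z]

/-- **`H_{q+1}(Z | K) = 0` when `H_{q+1}(Z) = 0` and `H_q(Z ∖ K) = 0`** (exactness of
`H_{q+1}(Z) → H_{q+1}(Z, Z ∖ K) → H_q(Z ∖ K)`, Hatcher 2002, Thm. 2.16). [cite: HatcherAT2002, Thm. 2.16] -/
theorem isZero_localHomologyOfSet_succ_of_isZero (K : Set Z) (q : ℕ)
    (hZ : IsZero (singularHomology R M Z (q + 1)))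
    (hK : IsZero (singularHomology R M ↥(Kᶜ) q)) :
    IsZero (localHomologyOfSet R M Z K (q + 1)) :=
  (relativeSingularHomology.exact_ofAbsolute_δ R M (X := Z) Kᶜ q).isZero_of_both_zeros
    (hZ.eq_of_src _ _) (hK.eq_of_tgt _ _)

/-- **`j_* : H_{q+1}(Z) ≅ H_{q+1}(Z | K)` when `H_{q+1}(Z ∖ K) = 0 = H_q(Z ∖ K)`** (exactness of
`H_{q+1}(Z ∖ K) → H_{q+1}(Z) → H_{q+1}(Z, Z ∖ K) → H_q(Z ∖ K)`, Hatcher 2002, Thm. 2.16).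
[cite: HatcherAT2002, Thm. 2.16] -/
theorem isIso_ofAbsolute_of_isZero (K : Set Z) (q : ℕ)
    (h₁ : IsZero (singularHomology R M ↥(Kᶜ) (q + 1)))
    (h₀ : IsZero (singularHomology R M ↥(Kᶜ) q)) :
    IsIso (relativeSingularHomology.ofAbsolute R M Z Kᶜ (q + 1)) := by
  have hmono : Mono (relativeSingularHomology.ofAbsolute R M Z Kᶜ (q + 1)) :=
    (relativeSingularHomology.exact_map_ofAbsolute R M (X := Z) Kᶜ (q + 1)).mono_g (h₁.eq_of_src _ _)
  have hepi : Epi (relativeSingularHomology.ofAbsolute R M Z Kᶜ (q + 1)) :=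
    (relativeSingularHomology.exact_ofAbsolute_δ R M (X := Z) Kᶜ q).epi_f (h₀.eq_of_tgt _ _)
  exact isIso_of_mono_of_epi _

/-- `j_*` followed by restriction is `j_*`: `H(Z) → H(Z | K) → H(Z | L)` is `H(Z) → H(Z | L)`
(functoriality of the long exact sequence of pairs, Hatcher 2002, §2.1). [folklore] -/
theorem ofAbsolute_comp_restrictLocal {K L : Set Z} (h : L ⊆ K) (q : ℕ) :
    relativeSingularHomology.ofAbsolute R M Z Kᶜ q ≫ restrictLocal R M h q =
      relativeSingularHomology.ofAbsolute R M Z Lᶜ q := by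
  rw [restrictLocal, relativeSingularHomology.ofAbsolute_comp_map, singularHomology.map_id,
    Category.id_comp]

/-- **Restriction `H_q(Z | K) → H_q(Z | L)` is onto (indeed an isomorphism) when `j_*` is an
isomorphism for both `K` and `L`** (e.g. `Z = Sⁿ`, `q = n`, and the complements of `K ⊇ L` have
no homology in degrees `n - 1`, `n`). [folklore] -/
theorem surjective_restrictLocal_of_isIso_ofAbsolute {K L : Set Z} (h : L ⊆ K) (q : ℕ)
    [IsIso (relativeSingularHomology.ofAbsolute R M Z Kᶜ q)]
    [IsIso (relativeSingularHomology.ofAbsolute R M Z Lᶜ q)] :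
    Surjective (restrictLocal R M h q) := by
  have hfac : restrictLocal R M h q =
      inv (relativeSingularHomology.ofAbsolute R M Z Kᶜ q) ≫
        relativeSingularHomology.ofAbsolute R M Z Lᶜ q := by
    rw [IsIso.eq_inv_comp, ofAbsolute_comp_restrictLocal]
  haveI : IsIso (restrictLocal R M h q) := by
    rw [hfac]
    infer_instance
  exact ((ModuleCat.epi_iff_surjective _).1 inferInstance)

/-- **`∂ : H_{q+1}(Z | K) ≃ H_q(Z ∖ K)` when `H_{q+1}(Z) = 0 = H_q(Z)`**, as a linear equivalence
(`relativeSingularHomology.isIso_δ_of_isZero`; e.g. `Z = Sⁿ` and `0 < q`, `q + 1 < n`).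
[cite: HatcherAT2002, Thm. 2.16] -/
theorem exists_linearEquiv_compl_of_isZero (K : Set Z) (q : ℕ)
    (h₁ : IsZero (singularHomology R M Z (q + 1))) (h₀ : IsZero (singularHomology R M Z q)) :
    Nonempty (localHomologyOfSet R M Z K (q + 1) ≃ₗ[R] singularHomology R M ↥(Kᶜ) q) :=
  haveI := relativeSingularHomology.isIso_δ_of_isZero R M (X := Z) Kᶜ q h₁ h₀
  ⟨(asIso (relativeSingularHomology.δ R M Z Kᶜ q)).toLinearEquiv⟩

end LES

end Literature.AlgebraicTopology.SingularHomology
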